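import Mathlib
import Literature.NumberTheory.Transcendental.KZProductIdeal
import Literature.NumberTheory.Transcendental.KZDominatedFamilyRelations
import Summits.KontsevichZagierPeriods.KontsevichZagierPeriods.Theorems.TorsionLogsGKZLevelThreePairTChainAffine
import Summits.KontsevichZagierPeriods.KontsevichZagierPeriods.Theorems.TorsionLogsGKZLevelThreePairTChainNL

/-!
# Route TorsionLogs — support item `GKZLevelThreePair`: the T-chain, the coordinate swap
# (`[{0<x<1, 0≤s≤2x√x/(1+x³)}, g(x,s)] ∼ [{0<s<1, m(s)^{2/3}≤x≤1}, g(x,s)]`)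

Helper file for item `stmt-KontsevichZagierPeriods-13812` (`GKZLevelThreePair`), blueprint v3. The
affine chart (step (N2), `…TChainAffine.lean`) produces the band OVER `x` with fibre
`0 ≤ s ≤ φ(x) = 2x√x/(1+x³)`; the Newton–Leibniz step (N3) (`…TChainNL.lean`) consumes the SAME
region written as a band OVER `s` with fibre `m(s)^{2/3} ≤ x ≤ 1`, `m(s) = (1-√(1-s²))/s`, the
variable of integration `x` being last. `sband_equivalent_xband` passes from one to the other inside
the Kontsevich–Zagier calculus: the coordinate permutation `(x,s) ↦ (s,x)` is a change of variables
(rule 2), `KZ.of_sub_of_reindex_mem_relations`), the two descriptions of the region agree off the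
null segments `s = 0`, `x = 1` (rule 1a)), because `s ≤ φ(x) ↔ m(s)^{2/3} ≤ x`
(`le_tailSubst_iff`: `φ` is increasing and `φ(m(s)^{2/3}) = s`).

## References

* M. Kontsevich, D. Zagier, *Periods* (2001), §1.2 rules (1), (2).
-/

-- `Summit.<Summit>.<Sub>` with Sub = Summit (single-conjunct summit, D-0017) duplicates the segment.
set_option linter.dupNamespace false

noncomputable section

namespace Summit.KontsevichZagierPeriods.KontsevichZagierPeriods.Theorems.GKZLevelThree

open Set MeasureTheory
open MvPolynomial (aeval X C)
open Literature.NumberTheory.Transcendental Literature.NumberTheory.Transcendental.KZ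
open Literature.ModelTheory.ExponentialFields (IsSemialgebraic isSemialgebraic_setOf_eval_pos)

/-! ## `φ(m(s)^{2/3}) = s` and `s ≤ φ(x) ↔ m(s)^{2/3} ≤ x` -/

/-- For `0 < s < 1`, `m = (1-√(1-s²))/s` satisfies `2m/(1+m²) = s`. -/
theorem two_mul_tailRoot_div {s : ℝ} (hs0 : 0 < s) (hs1 : s < 1) :
    2 * ((1 - Real.sqrt (1 - s ^ 2)) / s) / (1 + ((1 - Real.sqrt (1 - s ^ 2)) / s) ^ 2) = s := by
  obtain ⟨hq0, hq1⟩ := sqrt_one_sub_sq_mem hs0 hs1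
  set q := Real.sqrt (1 - s ^ 2) with hq
  have hq2 : q ^ 2 = 1 - s ^ 2 := by rw [hq, Real.sq_sqrt (by nlinarith)]
  have h1q : (1 - q) ≠ 0 := by linarith
  have hs : s ≠ 0 := hs0.ne'
  have hkey : s ^ 2 + (1 - q) ^ 2 = 2 * (1 - q) := by nlinarith [hq2]
  have hden : 1 + ((1 - q) / s) ^ 2 = 2 * (1 - q) / s ^ 2 := by
    rw [div_pow]
    field_simp
    linarith [hkey]
  rw [hden, div_div_eq_mul_div]
  field_simp

/-- `φ(a) = s` for `a = m(s)^{2/3}` (`0 < s < 1`), `φ(x) = 2x√x/(1+x³)`. -/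
theorem tailSubst_rpow_tailRoot {s : ℝ} (hs0 : 0 < s) (hs1 : s < 1) :
    2 * ((((1 - Real.sqrt (1 - s ^ 2)) / s) ^ ((2:ℝ) / 3)) *
      Real.sqrt (((1 - Real.sqrt (1 - s ^ 2)) / s) ^ ((2:ℝ) / 3))) /
      (1 + (((1 - Real.sqrt (1 - s ^ 2)) / s) ^ ((2:ℝ) / 3)) ^ 3) = s := by
  obtain ⟨hm0, -⟩ := tailRoot_pos_le_one hs0 hs1
  set m := (1 - Real.sqrt (1 - s ^ 2)) / s with hm
  obtain ⟨hsq, -⟩ := sqrt_rpow_two_thirds hm0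
  rw [hsq, ← Real.rpow_add hm0, show ((2:ℝ) / 3 + 1 / 3) = 1 by norm_num, Real.rpow_one]
  have h3 : (m ^ ((2:ℝ) / 3)) ^ 3 = m ^ 2 := by
    rw [← Real.rpow_natCast (m ^ ((2:ℝ) / 3)) 3, ← Real.rpow_mul hm0.le]
    norm_num
  rw [h3]
  exact two_mul_tailRoot_div hs0 hs1

/-- **The two descriptions of the band agree**: for `0 < s < 1` and `0 < x ≤ 1`,
`s ≤ φ(x) ↔ m(s)^{2/3} ≤ x` (`φ` is strictly increasing on `[0,1]`, `φ(m(s)^{2/3}) = s`). -/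
theorem le_tailSubst_iff {s x : ℝ} (hs0 : 0 < s) (hs1 : s < 1) (hx0 : 0 < x) (hx1 : x ≤ 1) :
    s ≤ 2 * (x * Real.sqrt x) / (1 + x ^ 3) ↔ ((1 - Real.sqrt (1 - s ^ 2)) / s) ^ ((2:ℝ) / 3) ≤ x := by
  obtain ⟨hm0, hm1⟩ := tailRoot_pos_le_one hs0 hs1
  set a := ((1 - Real.sqrt (1 - s ^ 2)) / s) ^ ((2:ℝ) / 3) with ha
  have ha0 : 0 < a := Real.rpow_pos_of_pos hm0 _
  have ha1 : a ≤ 1 := Real.rpow_le_one hm0.le hm1 (by norm_num)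
  have hφa : 2 * (a * Real.sqrt a) / (1 + a ^ 3) = s := tailSubst_rpow_tailRoot hs0 hs1
  conv_lhs => rw [← hφa]
  exact strictMonoOn_tailSubst.le_iff_le ⟨ha0.le, ha1⟩ ⟨hx0.le, hx1⟩

/-! ## The swap -/

/-- **The band over `x` and the band over `s` are KZ-equivalent.** For
`R₃ = [{0<x<1, 0 ≤ s ≤ φ(x)}, (3/2)(1+x)/(x√x√(1-s²))]` (coordinates `(x,s)`) and
`Rb = [{0<s<1, m(s)^{2/3} ≤ x ≤ 1}, (3/2)(1+x)/(x√x√(1-s²))]` (coordinates `(s,x)`), both pinned: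
`R₃ ∼ Rb`. The coordinate swap is one change of variables (`KZ.of_sub_of_reindex_mem_relations`);
the swapped region and `Rb.domain` have a common part `C = {0<s<1, 0<x<1, s ≤ φ(x)}` off the null
segments `{s = 0}` and `{x = 1}` (rule 1a)), on which the integrands agree.
[Kontsevich–Zagier 2001, §1.2 rules (1), (2)] -/
theorem sband_equivalent_xband (R₃ Rb : IntegralRep 2)
    (h3d : R₃.domain = KZlog.band {p : Fin 1 → ℝ | 0 < p 0 ∧ p 0 < 1} (fun _ => 0)
      (fun p => 2 * (p 0 * Real.sqrt (p 0)) / (1 + p 0 ^ 3)))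
    (h3i : EqOn R₃.integrand (fun z => 3 / 2 * (1 + z 0) / (z 0 * Real.sqrt (z 0) * Real.sqrt (1 - z 1 ^ 2)))
      R₃.domain)
    (hbd : Rb.domain = {z | (Fin.init z : Fin 1 → ℝ) ∈ {p : Fin 1 → ℝ | 0 < p 0 ∧ p 0 < 1} ∧
      ((1 - Real.sqrt (1 - (Fin.init z) 0 ^ 2)) / (Fin.init z) 0) ^ ((2:ℝ) / 3) ≤ z (Fin.last 1) ∧
      z (Fin.last 1) ≤ 1})
    (hbi : EqOn Rb.integrand (fun z => 3 / 2 * (1 + z 1) / (z 1 * Real.sqrt (z 1) * Real.sqrt (1 - z 0 ^ 2)))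
      Rb.domain) : Equivalent R₃ Rb := by
  set e : Fin 2 ≃ Fin 2 := Equiv.swap 0 1 with he
  have he0 : e 0 = 1 := by simp [he]
  have he1 : e 1 = 0 := by simp [he]
  have hinit : ∀ z : Fin 2 → ℝ, (Fin.init z) 0 = z 0 := fun z => rfl
  have hlast : (Fin.last 1 : Fin 2) = 1 := rfl
  -- membership in the two regions
  have hmem3 : ∀ w : Fin 2 → ℝ, w ∈ (R₃.reindex e).domain ↔
      (0 < w 1 ∧ w 1 < 1) ∧ 0 ≤ w 0 ∧ w 0 ≤ 2 * (w 1 * Real.sqrt (w 1)) / (1 + w 1 ^ 3) := by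
    intro w
    rw [IntegralRep.reindex_domain, h3d]
    simp only [mem_setOf_eq, KZlog.mem_band, he0, he1, Fin.init, hlast, Fin.castSucc_zero]
  have hmemb : ∀ z : Fin 2 → ℝ, z ∈ Rb.domain ↔
      (0 < z 0 ∧ z 0 < 1) ∧ ((1 - Real.sqrt (1 - z 0 ^ 2)) / z 0) ^ ((2:ℝ) / 3) ≤ z 1 ∧ z 1 ≤ 1 := by
    intro z
    rw [hbd]
    simp only [mem_setOf_eq, hinit, hlast]
  -- the common part
  set C : Set (Fin 2 → ℝ) := {w | (0 < w 0 ∧ w 0 < 1) ∧ (0 < w 1 ∧ w 1 < 1) ∧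
    w 0 ≤ 2 * (w 1 * Real.sqrt (w 1)) / (1 + w 1 ^ 3)} with hC
  have hCs : IsSemialgebraic ℚ C := by
    set S : Set (Fin 2 → ℝ) := {w | (0 < w 0 ∧ w 0 < 1) ∧ (0 < w 1 ∧ w 1 < 1)} with hSdef
    have hT : IsSemialgebraicFunOn ℚ S (fun w => 2 * (w 1 * Real.sqrt (w 1)) / (1 + w 1 ^ 3) - w 0) := by
      have hS : IsSemialgebraic ℚ S :=
        ((KZ.isSemialgebraic_setOf_const_lt_apply isAlgebraic_zero 0).inter
          (KZ.isSemialgebraic_setOf_apply_lt_const isAlgebraic_one 0)).inter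
          ((KZ.isSemialgebraic_setOf_const_lt_apply isAlgebraic_zero 1).inter
          (KZ.isSemialgebraic_setOf_apply_lt_const isAlgebraic_one 1))
      have hX0 : IsSemialgebraicFunOn ℚ S (fun w : Fin 2 → ℝ => w 0) :=
        (isSemialgebraicFunOn_aeval hS (X 0 : MvPolynomial (Fin 2) ℚ)).congr fun z _ => by simp
      have hX1 : IsSemialgebraicFunOn ℚ S (fun w : Fin 2 → ℝ => w 1) :=
        (isSemialgebraicFunOn_aeval hS (X 1 : MvPolynomial (Fin 2) ℚ)).congr fun z _ => by simp
      have hsq : IsSemialgebraicFunOn ℚ S (fun w : Fin 2 → ℝ => Real.sqrt (w 1)) :=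
        IsSemialgebraicFunOn.sqrt_holds hX1
      have h2 : IsSemialgebraicFunOn ℚ S (fun _ : Fin 2 → ℝ => (2:ℝ)) := by
        simpa using isSemialgebraicFunOn_const_of_isAlgebraic hS (isAlgebraic_nat (R := ℚ) (A := ℝ) 2)
      have hnum : IsSemialgebraicFunOn ℚ S (fun w : Fin 2 → ℝ => 2 * (w 1 * Real.sqrt (w 1))) :=
        (IsSemialgebraicFunOn.mul_holds h2 (IsSemialgebraicFunOn.mul_holds hX1 hsq)).congr fun p _ => rfl
      have hden : IsSemialgebraicFunOn ℚ S (fun w : Fin 2 → ℝ => 1 + w 1 ^ 3) :=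
        (isSemialgebraicFunOn_aeval hS (1 + X 1 ^ 3 : MvPolynomial (Fin 2) ℚ)).congr fun z _ => by simp
      have hφ : IsSemialgebraicFunOn ℚ S (fun w : Fin 2 → ℝ => 2 * (w 1 * Real.sqrt (w 1)) / (1 + w 1 ^ 3)) :=
        (hnum.div hden fun w hw => one_add_cube_ne_zero hw.2.1.le).congr fun p _ => rfl
      exact (IsSemialgebraicFunOn.sub_holds hφ hX0).congr fun p _ => rfl
    convert hT.isSemialgebraic_sep_nonneg using 1
    ext w
    simp only [hC, hSdef, mem_setOf_eq, sub_nonneg]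
    tauto
  -- `C` inside both regions
  have hC3 : C ⊆ (R₃.reindex e).domain := fun w hw => by
    rw [hmem3]
    exact ⟨hw.2.1, hw.1.1.le, hw.2.2⟩
  have hCb : C ⊆ Rb.domain := fun w hw => by
    rw [hmemb]
    exact ⟨hw.1, (le_tailSubst_iff hw.1.1 hw.1.2 hw.2.1.1 hw.2.1.2.le).1 hw.2.2, hw.2.1.2.le⟩
  -- the complements are null
  have hnull3 : volume ((R₃.reindex e).domain \ C) = 0 := by
    have h0 : volume {w : Fin 2 → ℝ | w 0 = 0} = 0 := by
      rw [volume_pi]; exact Measure.pi_hyperplane _ _ _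
    refine measure_mono_null (fun w hw => ?_) h0
    obtain ⟨hw, hnot⟩ := hw
    rw [hmem3] at hw
    obtain ⟨hx, hs0, hs1⟩ := hw
    have hslt : w 0 < 1 := hs1.trans_lt (tailSubst_lt_one hx.1 hx.2)
    simp only [hC, mem_setOf_eq, not_and, not_le] at hnot
    show w 0 = 0
    rcases hs0.lt_or_eq with h | h
    · exact absurd hs1 (not_le.2 (hnot ⟨h, hslt⟩ hx))
    · exact h.symm
  have hnullb : volume (Rb.domain \ C) = 0 := by
    have h1 : volume {w : Fin 2 → ℝ | w (Fin.last 1) = 1} = 0 := KZ.volume_setOf_last_eq_zero 1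
    refine measure_mono_null (fun w hw => ?_) h1
    obtain ⟨hw, hnot⟩ := hw
    rw [hmemb] at hw
    obtain ⟨hs, ha, hx1⟩ := hw
    have ha0 : 0 < ((1 - Real.sqrt (1 - w 0 ^ 2)) / w 0) ^ ((2:ℝ) / 3) :=
      Real.rpow_pos_of_pos (tailRoot_pos_le_one hs.1 hs.2).1 _
    have hx0 : 0 < w 1 := ha0.trans_le ha
    simp only [hC, mem_setOf_eq, not_and, not_le] at hnot
    show w 1 = 1
    rcases hx1.lt_or_eq with h | h
    · exact absurd ((le_tailSubst_iff hs.1 hs.2 hx0 hx1).2 ha) (not_le.2 (hnot hs ⟨hx0, h⟩))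
    · exact h
  -- the four pieces of the chain
  have h1 : of R₃ - of (R₃.reindex e) ∈ relations := of_sub_of_reindex_mem_relations R₃ e
  have h2 : of (R₃.reindex e) - of ((R₃.reindex e).restrict C hCs hC3) ∈ relations :=
    (R₃.reindex e).of_sub_of_restrict_mem_relations hCs hC3 hnull3
  have h3 : of Rb - of (Rb.restrict C hCs hCb) ∈ relations :=
    Rb.of_sub_of_restrict_mem_relations hCs hCb hnullb
  have h4 : of ((R₃.reindex e).restrict C hCs hC3) - of (Rb.restrict C hCs hCb) ∈ relations := by
    refine of_sub_of_mem_relations_of_eqOn rfl fun w hw => ?_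
    have hw' : w ∈ C := hw
    rw [IntegralRep.integrand_restrict, IntegralRep.integrand_restrict, IntegralRep.reindex_integrand]
    show R₃.integrand (fun i => w (e i)) = Rb.integrand w
    rw [h3i (hC3 hw'), hbi (hCb hw')]
    simp only [he0, he1]
  have : of R₃ - of Rb = (of R₃ - of (R₃.reindex e)) + (of (R₃.reindex e) - of ((R₃.reindex e).restrict C hCs hC3)) +
      (of ((R₃.reindex e).restrict C hCs hC3) - of (Rb.restrict C hCs hCb)) - (of Rb - of (Rb.restrict C hCs hCb)) := by
    abel
  show of R₃ - of Rb ∈ relations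
  rw [this]
  exact relations.sub_mem (relations.add_mem (relations.add_mem h1 h2) h4) h3

end Summit.KontsevichZagierPeriods.KontsevichZagierPeriods.Theorems.GKZLevelThree

end
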